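import Summits.MatrixMultiplication.MatrixMultiplication.Theorems.ObstructionDescentDoubleDegree

/- `set_option linter.dupNamespace false` as in the sibling kernel files (namespace `…Theorems.<FileStem>`). -/
set_option linter.dupNamespace false

/-!
# Obstruction descent — the certified blind DEGREE WINDOW, in the dictionary of `E` (hulls, truncated border rank)

Route `route-MatrixMultiplication-ObstructionDescent` (`ω(ℂ) = 2`), attacked leaf `E = NoPolyDegreeObstruction` (item 30889).  The hull
dictionary of `E` (`ObstructionDescentHullDescent.noPolyDegreeObstruction_iff_hull` / `_iff_truncRank`): row `c` of `E` says that
`⟨n,n,n⟩` lies in the degree-`m^c` hull of `σ_m` of the corner format, i.e. `R_{m^c}(⟨n,n,n⟩) ≤ m`, at the cells `m ≥ n^τ`.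

This file restates rung R3 (items 27778 + 27779 + 27780, all PROVED: `gapOneEquationsVanish_holds`, `gapPropagation_holds`,
`doubleDegreeBlind_holds`) in that dictionary, via the corner alternative `ObstructionDescentDoubleDegree.rv_eq_zero_of_degree_le`:

* `mem_hull_of_window` / `truncRank_le_of_window`: for `2 ≤ N` and `D + 3N ≤ 2m + 4`, EVERY tensor of `(ℂ^N)^{⊗3}` lies in `Hull_D(σ_m)`;
  equivalently `R_D(t) ≤ ⌈(D + 3N − 4)/2⌉` uniformly in `t` — linear in `N`, although generic border rank in this format is `≍ N²/3`.
* `matMulTensor_mem_hull_of_window` / `truncRank_matMulTensor_le_of_window`: the same for `⟨n,n,n⟩` in its own corner format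
  `(ℂ^{n×n})^{⊗3}` (`N = n²`, transported along `finProdFinEquiv` by `hull_precomp`): `⟨n,n,n⟩ ∈ Hull_D(σ_m)` whenever `D + 3n² ≤ 2m + 4`.

HONEST PLACEMENT: the window covers the degree budgets `D ≤ 2m − 3n² + 4` — beyond row 1 of `E` (`D ≤ m`, `FormatDegreeBlind`, item 30920)
and strictly short of row 2 (`D = m²`), so it closes no row of `E`; it certifies that any polynomial obstruction separating `pad_m⟨n,n,n⟩`
from `σ_m` has degree `≥ 2m − 3n² + 5`.  [this cell, NODE-g23 §4; cites: LandsbergGCT2017 §8.3.2 (hulls, Prop. 8.3.4.2), LandsbergManivel2004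
Prop. 3.3, Blaser2013 Lemma 5.4]
-/

namespace Summit.MatrixMultiplication.MatrixMultiplication.Theorems.ObstructionDescentDegreeWindow

open MvPolynomial Finset
open ObstructionDescentTorusLaws (RV mem_RV)
open ObstructionDescentHullCalculus (hull mem_hull hull_precomp truncRank mem_hull_iff_truncRank_le)
open ObstructionDescentDoubleDegree (rv_eq_zero_of_degree_le)
open Literature.Computability.AlgebraicComplexity (tensorRank matMulTensor)

variable {N m D : ℕ}

/-- WINDOW THEOREM (hull form).  For `2 ≤ N` and `D + 3N ≤ 2m + 4`, every tensor of the format `(ℂ^N)^{⊗3}` lies in the degree-`D`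
hull of `σ_m`: there is no non-zero equation of `σ_m((ℂ^N)^{⊗3})` of degree `≤ 2m − 3N + 4`. [this cell, NODE-g23 §4] -/
theorem mem_hull_of_window (hN : 2 ≤ N) (hD : D + 3 * N ≤ 2 * m + 4) (t : Fin N → Fin N → Fin N → ℂ) :
    t ∈ hull (Fin N) (Fin N) (Fin N) m D := by
  rw [mem_hull]
  intro f hf hRV
  rw [rv_eq_zero_of_degree_le hN f hRV (by omega), map_zero]

/-- WINDOW THEOREM (truncated border rank form): `R_D(t) ≤ m` for every `t ∈ (ℂ^N)^{⊗3}` once `2m ≥ D + 3N − 4`.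
[this cell; LandsbergGCT2017 §8.3.2 for `R_D`] -/
theorem truncRank_le_of_window (hN : 2 ≤ N) (hD : D + 3 * N ≤ 2 * m + 4) (t : Fin N → Fin N → Fin N → ℂ) :
    truncRank D t ≤ m :=
  mem_hull_iff_truncRank_le.1 (mem_hull_of_window hN hD t)

/-- The window in the rows of `E`: `⟨n,n,n⟩ ∈ Hull_D(σ_m)` in the corner format `(ℂ^{n×n})^{⊗3}` whenever `D + 3n² ≤ 2m + 4`, `n ≥ 2`
(compare `noPolyDegreeObstruction_iff_hull`: row `c` of `E` asks this for `D = m^c` at `m ≥ n^τ`). [this cell, NODE-g23 §4] -/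
theorem matMulTensor_mem_hull_of_window {n : ℕ} (hn : 2 ≤ n) (hD : D + 3 * (n * n) ≤ 2 * m + 4) :
    (fun a b c => matMulTensor ℂ n n n a b c) ∈ hull (Fin n × Fin n) (Fin n × Fin n) (Fin n × Fin n) m D := by
  have hN : 2 ≤ n * n := le_trans hn (Nat.le_mul_self n)
  have hs := mem_hull_of_window hN hD (fun i j k => matMulTensor ℂ n n n
    ((finProdFinEquiv : Fin n × Fin n ≃ Fin (n * n)).symm i) ((finProdFinEquiv : Fin n × Fin n ≃ Fin (n * n)).symm j)
    ((finProdFinEquiv : Fin n × Fin n ≃ Fin (n * n)).symm k))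
  have h := hull_precomp hs (finProdFinEquiv : Fin n × Fin n ≃ Fin (n * n)) (finProdFinEquiv : Fin n × Fin n ≃ Fin (n * n))
    (finProdFinEquiv : Fin n × Fin n ≃ Fin (n * n))
  simpa only [Equiv.symm_apply_apply] using h

/-- `R_D(⟨n,n,n⟩) ≤ m` whenever `D + 3n² ≤ 2m + 4` (`n ≥ 2`): the truncated border rank of matrix multiplication is quadratic in `n`
under every degree budget `D ≤ 2m − 3n² + 4` — the budgets between row 1 (`D ≤ m`) and row 2 (`D ≤ m²`) of `E`. [this cell, NODE-g23 §4] -/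
theorem truncRank_matMulTensor_le_of_window {n : ℕ} (hn : 2 ≤ n) (hD : D + 3 * (n * n) ≤ 2 * m + 4) :
    truncRank D (fun a b c => matMulTensor ℂ n n n a b c) ≤ m :=
  mem_hull_iff_truncRank_le.1 (matMulTensor_mem_hull_of_window hn hD)

end Summit.MatrixMultiplication.MatrixMultiplication.Theorems.ObstructionDescentDegreeWindow
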